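import Literature.AlgebraicGeometry.Frobenioids.ModelFrobenioidMap
import HarnessLib

/-!
# Frobenioids I, Corollary 5.4 (strong 1-uniqueness at THE data): hom-rigidity along a functor of model
# Frobenioids reduces to identity-base linear morphisms (sub-DAG row C54-core-arith, sub-row (4), file 4a)

Mochizuki, *The geometry of Frobenioids I: the general theory*, Kyushu J. Math. **62** (2008) 293–400,
Corollary 5.4, kurims p. 104 ll. 1–9 ("there exists a 1-unique functor `Ψ^rlf : C₁^rlf → C₂^rlf` …"), with
the model descriptions of Prop. 5.3 p. 103 and the morphisms `(deg_Fr, Base, Div, u)` of Thm. 5.2 (i) p. 100.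
[cite: MochizukiFrdI2008, Cor. 5.4 p.104] [cite: MochizukiFrdI2008, Thm. 5.2(i) p.100]

PROOF-ONLY file (cell abc-iut, seat abc-iut-L1-d8; sub-row (4) of abc-iut-w5-d048's split of row
C54-core-arith; no definitions). `Cor54RigidityReduction.lean` (`FrdI.Cor54Sub.rigidAlong_of_essSurj_of_homRigid`)
reduces rigidity along an essentially surjective functor `G` to HOM-RIGIDITY of its image: every functorial
self-map `ρ` of the morphisms between `G`-image objects fixing the morphisms `G f` is the identity. Here `G` is
the functor of model Frobenioids `h.functor : (Φ, B, Div_B)-model → (Φ', B', Div_B')-model` induced by a morphism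
of model data `h` (`ModelFrobenioidMap.lean`) — for `h = RealificationData.ofBaseData` this is
`C^un-tr → C^rlf` of Prop. 5.3 (`untrToRlf`) — and we prove the first reduction step of the hom-rigidity
argument at `C_{K/F}`:

* `ModelFrobenioid.DataHom.exists_fac_linear` — every morphism `k : G(A, α) → G(A', α')` factors as
  `G(Fr_d) ≫ k₁ ≫ G(pb_f)` with `Fr_d = (d, 𝟙, 0, 0) : (A, α) → (A, d · α)` (a morphism of Frobenius type) and
  `pb_f = (1, f, 0, 0) : (A, f^* α') → (A', α')` (a pull-back morphism) morphisms of the SOURCE model, and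
  `k₁ = (1, 𝟙_A, Div k, u_k)` an identity-base linear morphism between image objects over the one base object `A`;
* `ModelFrobenioid.DataHom.homRigid_of_homRigid_linear` — hence a functorial `ρ` fixing the `G`-images is the
  identity as soon as it fixes the identity-base linear morphisms between image objects.

Pure model-Frobenioid algebra (Thm. 5.2 (i)); nothing here bears on [IUTchIII] Cor. 3.12.
-/

noncomputable section

namespace Literature.AlgebraicGeometry.Frobenioids

open CategoryTheory Opposite

universe w v u

namespace ModelFrobenioid.DataHom

variable {D : Type u} [Category.{v} D] {Φ B Φ' B' : Dᵒᵖ ⥤ CommMonCat.{w}} {DivB : B ⟶ monoidGp Φ}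
  {DivB' : B' ⟶ monoidGp Φ'} (h : DataHom DivB DivB')

/-- `G = h.functor` does not change the Frobenius degree (Prop. 5.3, "the functors that arise naturally").
[cite: MochizukiFrdI2008, Prop. 5.3 p.103] -/
theorem degFr_functor_map {X Y : ModelFrobenioid Φ B DivB} (φ : X ⟶ Y) :
    degFr (h.functor.map φ) = degFr φ := rfl

/-- `G = h.functor` does not change the base morphism. [cite: MochizukiFrdI2008, Prop. 5.3 p.103] -/
theorem baseMap_functor_map {X Y : ModelFrobenioid Φ B DivB} (φ : X ⟶ Y) :
    baseMap (h.functor.map φ) = baseMap φ := rfl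

/-- `G = h.functor` maps the zero divisor by `η`. [cite: MochizukiFrdI2008, Prop. 5.3 p.103] -/
theorem div_functor_map {X Y : ModelFrobenioid Φ B DivB} (φ : X ⟶ Y) :
    div (h.functor.map φ) = (h.η.app (op X.base)).hom (div φ) := rfl

/-- `G = h.functor` maps the unit coordinate by `β`. [cite: MochizukiFrdI2008, Prop. 5.3 p.103] -/
theorem unit_functor_map {X Y : ModelFrobenioid Φ B DivB} (φ : X ⟶ Y) :
    unit (h.functor.map φ) = (h.β.app (op X.base)).hom (unit φ) := rfl

/-- **Every morphism between image objects is `G(Frobenius-type) ≫ (identity-base linear) ≫ G(pull-back)`**: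
for `k : G(A, α) → G(A', α')` with `d := deg_Fr(k)`, `f := Base(k)`, the morphisms `Fr_d = (d, 𝟙_A, 0, 0) :
(A, α) → (A, d · α)` and `pb_f = (1, f, 0, 0) : (A, f^* α') → (A', α')` of the source model and
`k₁ := (1, 𝟙_A, Div k, u_k) : G(A, d · α) → G(A, f^* α')` satisfy `G(Fr_d) ≫ k₁ ≫ G(pb_f) = k` (relation (d) of
Thm. 5.2 (i) for `k₁` is that of `k`, transported by `η^gp ∘ Φ(f) = Φ'(f) ∘ η^gp`).
[cite: MochizukiFrdI2008, Thm. 5.2(i) p.100] -/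
theorem exists_fac_linear (A : D) (α : Algebra.GrothendieckGroup (Φ.obj (op A))) (A' : D)
    (α' : Algebra.GrothendieckGroup (Φ.obj (op A'))) (k : h.functor.obj ⟨A, α⟩ ⟶ h.functor.obj ⟨A', α'⟩) :
    ∃ (d : ℕ+) (f : A ⟶ A') (Fr : (⟨A, α⟩ : ModelFrobenioid Φ B DivB) ⟶ ⟨A, α ^ (d : ℕ)⟩)
      (pb : (⟨A, pullGp Φ f α'⟩ : ModelFrobenioid Φ B DivB) ⟶ ⟨A', α'⟩)
      (k₁ : h.functor.obj ⟨A, α ^ (d : ℕ)⟩ ⟶ h.functor.obj ⟨A, pullGp Φ f α'⟩),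
      degFr k₁ = 1 ∧ baseMap k₁ = 𝟙 A ∧ h.functor.map Fr ≫ k₁ ≫ h.functor.map pb = k := by
  -- the components of `k`
  obtain ⟨d, f, z, uu, hrel⟩ := k
  change A ⟶ A' at f
  change ↥(Φ'.obj (op A)) at z
  change ↥(B'.obj (op A)) at uu
  refine ⟨d, f, ⟨d, 𝟙 A, 1, 1, ?_⟩, ⟨1, f, 1, 1, ?_⟩, ⟨1, 𝟙 A, z, uu, ?_⟩, rfl, rfl, ?_⟩
  · -- relation (d) for the Frobenius-type morphism `(d, 𝟙, 0, 0) : (A, α) → (A, d · α)`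
    rw [map_one, mul_one, map_one, mul_one, pullGp_id]
  · -- relation (d) for the pull-back morphism `(1, f, 0, 0) : (A, f^* α') → (A', α')`
    rw [PNat.one_coe, pow_one, map_one, mul_one, map_one, mul_one]
  · -- relation (d) for `k₁`: that of `k`, transported
    have hr : (gpApp h.η (op A) α) ^ (d : ℕ) * Algebra.GrothendieckGroup.of z =
        pullGp Φ' f (gpApp h.η (op A') α') * divB Φ' B' DivB' (op A) uu := hrel
    show (gpApp h.η (op A) (α ^ (d : ℕ))) ^ ((1 : ℕ+) : ℕ) * Algebra.GrothendieckGroup.of z =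
        pullGp Φ' (𝟙 A) (gpApp h.η (op A) (pullGp Φ f α')) * divB Φ' B' DivB' (op A) uu
    rw [PNat.one_coe, pow_one, map_pow, pullGp_id, gpApp_pullGp]
    exact hr
  · apply hom_ext
    · show 1 * 1 * d = d
      rw [one_mul, one_mul]
    · show 𝟙 A ≫ 𝟙 A ≫ f = f
      rw [Category.id_comp, Category.id_comp]
    · show (Φ'.map (𝟙 A).op).hom
          ((Φ'.map (𝟙 A).op).hom ((h.η.app (op A)).hom 1) * z ^ ((1 : ℕ+) : ℕ)) *
          ((h.η.app (op A)).hom 1) ^ ((1 * 1 : ℕ+) : ℕ) = z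
      rw [map_one, map_one, one_mul, one_pow, mul_one, PNat.one_coe, pow_one, op_id, Φ'.map_id,
        CommMonCat.hom_id, MonoidHom.id_apply]
    · show (B'.map (𝟙 A).op).hom
          ((B'.map (𝟙 A).op).hom ((h.β.app (op A)).hom 1) * uu ^ ((1 : ℕ+) : ℕ)) *
          ((h.β.app (op A)).hom 1) ^ ((1 * 1 : ℕ+) : ℕ) = uu
      rw [map_one, map_one, one_mul, one_pow, mul_one, PNat.one_coe, pow_one, op_id, B'.map_id,
        CommMonCat.hom_id, MonoidHom.id_apply]

/-- **Hom-rigidity along `G = h.functor` reduces to identity-base linear morphisms.** Let `ρ` be a functorial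
self-map of the morphisms between `G`-image objects (`ρ(k ≫ l) = ρ(k) ≫ ρ(l)`) fixing the morphisms `G f`. If `ρ`
fixes every morphism `k : G(A, γ) → G(A, γ')` over one base object `A` with `deg_Fr(k) = 1` and `Base(k) = 𝟙_A`, then
`ρ` is the identity — the hypothesis of `FrdI.Cor54Sub.rigidAlong_of_essSurj_of_homRigid` for `G`.
[cite: MochizukiFrdI2008, Cor. 5.4 p.104] -/
theorem homRigid_of_homRigid_linear
    (ρ : ∀ ⦃a a' : ModelFrobenioid Φ B DivB⦄,
      (h.functor.obj a ⟶ h.functor.obj a') → (h.functor.obj a ⟶ h.functor.obj a'))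
    (hcomp : ∀ ⦃a a' a'' : ModelFrobenioid Φ B DivB⦄ (k : h.functor.obj a ⟶ h.functor.obj a')
      (l : h.functor.obj a' ⟶ h.functor.obj a''), ρ (k ≫ l) = ρ k ≫ ρ l)
    (hmap : ∀ ⦃a a' : ModelFrobenioid Φ B DivB⦄ (f : a ⟶ a'), ρ (h.functor.map f) = h.functor.map f)
    (hlin : ∀ (A : D) (γ γ' : Algebra.GrothendieckGroup (Φ.obj (op A)))
      (k : h.functor.obj ⟨A, γ⟩ ⟶ h.functor.obj ⟨A, γ'⟩), degFr k = 1 → baseMap k = 𝟙 A → ρ k = k) :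
    ∀ ⦃a a' : ModelFrobenioid Φ B DivB⦄ (k : h.functor.obj a ⟶ h.functor.obj a'), ρ k = k := by
  rintro ⟨A, α⟩ ⟨A', α'⟩ k
  obtain ⟨d, f, Fr, pb, k₁, hd, hb, hfac⟩ := h.exists_fac_linear A α A' α' k
  have h₁ : ρ k₁ = k₁ := hlin A _ _ k₁ hd hb
  rw [← hfac, hcomp, hcomp, hmap, hmap, h₁]

end ModelFrobenioid.DataHom

end Literature.AlgebraicGeometry.Frobenioids
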